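import Mathlib
import Summits.Ventures.PercRepro.PuncturedLYMTypeLiftFourTwelve
import Summits.Ventures.PercRepro.PuncturedLYMTypeLiftFourThirteen
import Summits.Ventures.PercRepro.PuncturedLYMTypeLiftFourFourteen
import Summits.Ventures.PercRepro.PuncturedLYMTypeLiftFourFifteen
import Summits.Ventures.PercRepro.PuncturedLYMTypeLiftFourSixteen
import Summits.Ventures.PercRepro.PuncturedLYMQuadSymMain

/-!
# PercRepro — (SP) FOR FOUR PAIRWISE DISJOINT TRIPLES AT LEVEL 4 ON EVERY GROUND SET
(p10, gen 39)

THE THEOREM `puncturedNMP_four_triples`: for every finite type and every four pairwise disjoint `3`-subsets, (SP) holds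
at level `4` for the `4`-sets containing none of them (`n ≥ 12` is forced by the members): the numeric type certificates
for `n = 12, 13, 14, 15, 16` and the symbolic certificate for `n = m + 17`.
-/

namespace PercRepro.PuncturedLYM.Split.TypeLift

open Finset

variable {α : Type} [DecidableEq α] [Fintype α]

/-- **THEOREM. (SP) for four pairwise disjoint triples at level `4`, on every ground set.** -/
theorem puncturedNMP_four_triples (C : Fin 4 → Finset α) (hcard : ∀ i, (C i).card = 3)
    (hdisj : ∀ i l, i ≠ l → Disjoint (C i) (C l)) :
    PuncturedNMP 4 ((univ : Finset (Fin 4)).biUnion (fun i => upLevel 4 (C i))) := by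
  have h12 : 12 ≤ Fintype.card α := by
    have := card_le_univ ((univ : Finset (Fin 4)).biUnion C)
    rw [card_biUnion (fun i _ l _ hil => hdisj i l hil)] at this
    simp only [hcard, sum_const, card_univ, Fintype.card_fin, smul_eq_mul] at this
    omega
  rcases Nat.lt_or_ge (Fintype.card α) 17 with hlt | hge
  · interval_cases hn : Fintype.card α
    · exact FourTwelve.puncturedNMP_four_twelve hn C hcard hdisj
    · exact FourThirteen.puncturedNMP_four_thirteen hn C hcard hdisj
    · exact FourFourteen.puncturedNMP_four_fourteen hn C hcard hdisj
    · exact FourFifteen.puncturedNMP_four_fifteen hn C hcard hdisj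
    · exact FourSixteen.puncturedNMP_four_sixteen hn C hcard hdisj
  · obtain ⟨m, hm⟩ : ∃ m, Fintype.card α = m + 17 := ⟨Fintype.card α - 17, by omega⟩
    exact QuadSym.puncturedNMP_four_triples_of_seventeen_le m hm C hcard hdisj

end PercRepro.PuncturedLYM.Split.TypeLift
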